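import Literature.Probability.LatticeModels.GlauberStrongMixingUniqueness
import HarnessLib

/-!
# Bounds on relative densities under a change of boundary condition ([Mar99] §2.4: (2.18), Lemma 2.8,
# and the third line of (2.15) in the proof of Theorem 2.7 (ii) ⇒ (i)), PROVED

Topic `Literature/Probability/LatticeModels`; companion of `StrongMixingFiniteSize.lean` (the named facts
`Martinelli1999_strongMixing_iff_SMT` = [Mar99] Thm 2.7 and `Martinelli1999_effectiveness` = Prop. 2.9 live
there) and of `GlauberStrongMixingUniqueness.lean` (the boundary-flip tilt `integral_spec_spinFlip_mul`, the
weights `Glauber.flipWeight` = [Mar99]'s `h_x = e^{−∇_x H}`).  Cell `ym-ir`, seat lit-3 (census row B2).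
Theorems only; no definition, no named fact (D-0026).  These are the two «bounds on relative densities» of
[Mar99] §2.4 on which the proofs of Theorem 2.7 (ii) ⇒ (i), Proposition 2.9 / Lemma 2.10 (effectiveness) and
Proposition 2.12 run; they are vendored here as PROVED steps towards those facts (which remain open in the tree).
SIBLING-SETTING results (finite-range interactions, `±1` spins on `ℤ^d`); nothing here is a statement about gauge
theories, and the Yang–Mills mass gap is not touched by it.

Source (held; locators = page files of `book:bertoin1999-lectures-probability-theory-statistics`):
[Mar99] F. Martinelli, *Lectures on Glauber dynamics for discrete spin models*, LNM 1717 (1999) 93–191: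
Theorem 2.7 p0158 L19–22 and the proof of (ii) ⇒ (i) p0160 L5–16 ((2.14)–(2.15)); **Lemma 2.8** p0160 L1–4 and
its proof p0160 L17–30 («proceeding as in Lemma 3.1 of [MO2]» — Martinelli–Olivieri, CMP 161 (1994), not
held); the formula **(2.18)** p0161 L21–36 (DLR, Markov property, one boundary site at a time,
`|μ_A^{τ^x}(f) − μ_A^τ(f)| = |μ_A^τ(h_x, f)|/μ_A^τ(h_x) ≤ e^{8‖J‖}|μ_A^τ(h_x, f)|`). [cite: Martinelli1999, Lemma 2.8]

## Contents (all for `γ = U.spec β`, `R ≥ 1` with `R⁻¹ ≤ h ≤ R` from `Glauber.exists_flipWeight_bounds`)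

* `Glauber.abs_integral_spec_spinFlip_sub_le` — (2.18), one flip: `|μ_Λ^{τ^y}(F) − μ_Λ^τ(F)| ≤ R |μ_Λ^τ(F; h_y)|`
  for `y ∉ Λ` and `F` not reading the spin at `y`.
* `Glauber.abs_integral_spec_sub_le_sum` — (2.18), telescoped with the finite-range Markov property: if every
  boundary site of `Λ` where `η ≠ η'` lies in a set `S` not read by `F` (and `η = η'` on the exterior coordinates
  read by `F`), then `|μ_Λ^η(F) − μ_Λ^{η'}(F)| ≤ R Σ_{y∈S} c_y`, `c_y ≥ sup_ζ |μ_Λ^ζ(F; h_y)|`.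
* `Glauber.abs_spec_real_spinFlip_sub_le_sum_cov` — **Lemma 2.8** in probability form: for `Δ ⊆ V`, `x ∉ V`,
  `d(x,Δ) > r`, `U = V ∖ Δ` and a `Δ`-local event `A`,
  `|μ_V^{τ^x}(A) − μ_V^τ(A)| ≤ 2R² Σ_{y∈Δ} c_y`, `c_y ≥ sup_ζ |μ_U^ζ(h_x; h_y)|`.  (Printed for the density
  `dμ_V^{τ^x}/dμ_V^τ|_Δ` in sup norm with the constant `e^{16‖J‖}`; on the two-point-per-site space the
  eventwise form is equivalent up to constants.  Our proof replaces [MO2]'s `log Z` interpolation by: the flip is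
  a tilt by `h_x`, `μ_V^τ(1_A h_x) = μ_V^τ(1_A μ_U(h_x))` (DLR), and the oscillation of `σ ↦ μ_U^σ(h_x)` over
  `σ = τ off V` is `≤ R Σ_{y∈Δ} c_y` by (2.18) in `U`.)
* `Glauber.abs_spec_real_spinFlip_sub_le_sum_exp` — **(2.15), third line**: under `SMT(V ∖ Δ, l, m)` for all
  boundary conditions, `|μ_V^{τ^x}(A) − μ_V^τ(A)| ≤ 4R⁴(2r+1)^{2d} e^{m(l+2r)} Σ_{y∈Δ} e^{−m d(x,y)}`.
  What is NOT done here (the rest of (ii) ⇒ (i)): [Mar99]'s replacement of `Δ` by the enlarged `Δ̂` (so that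
  `V ∖ Δ̂` is a multiple of `Q_{L₀}` and hypothesis (ii) applies) and the lattice sum
  `Σ_{y∈Δ̂} e^{−m d(x,y)} ≤ C e^{−m' d(x,Δ)}` giving `SM(V, C, m')`. -- TODO(general form)
* `Glauber.bavg_mul_of_dependsOn` (pull-out rule), `Glauber.supDist_le_finsetSupDist_rNeighbourhood_add`
  (`d(x,y) ≤ d(N_r x, N_r y) + 2r`).
-/

open MeasureTheory ProbabilityTheory Finset

noncomputable section

namespace Literature.Probability.LatticeModels

namespace Glauber

variable {d r : ℕ}

section RelativeDensities

/-- Pull-out rule: a factor not reading the spins in `Λ` passes through the block average `μ_Λ`.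
[cite: Martinelli1999, §2.2 (2.1)–(2.2)] -/
theorem bavg_mul_of_dependsOn {γ : Specification (Site d) ℤˣ} (hγ : IsSpecification γ) (Λ : Finset (Site d))
    {f : (Site d → ℤˣ) → ℝ} {T : Set (Site d)} (hf : DependsOn f T) (hT : ∀ x ∈ T, x ∉ Λ)
    (g : (Site d → ℤˣ) → ℝ) (σ : Site d → ℤˣ) :
    bavg γ Λ (fun ω => f ω * g ω) σ = f σ * bavg γ Λ g σ := by
  have hae : ∀ᵐ ω ∂(γ Λ σ), f ω * g ω = f σ * g ω := by
    filter_upwards [hγ.proper Λ σ] with ω hω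
    rw [hf fun x hx => hω x (hT x hx)]
  unfold bavg
  rw [integral_congr_ae hae, integral_const_mul]

/-- **One boundary flip, general observable** ([Mar99] (2.18), fourth line): for `y ∉ Λ` and an observable `F`
not reading the spin at `y`, `|μ_Λ^{τ^y}(F) − μ_Λ^τ(F)| = |μ_Λ^τ(F; h_y)|/μ_Λ^τ(h_y) ≤ R |μ_Λ^τ(F; h_y)|`.
[cite: Martinelli1999, Proposition 2.9, proof, (2.18)] -/
theorem abs_integral_spec_spinFlip_sub_le (U : FRPotential d ℤˣ r) (β : ℝ) {R : ℝ} (hR1 : 1 ≤ R)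
    (hR : ∀ (Λ : Finset (Site d)) (y : Site d) (σ : Site d → ℤˣ),
      R⁻¹ ≤ flipWeight U β Λ y σ ∧ flipWeight U β Λ y σ ≤ R)
    {Λ : Finset (Site d)} {y : Site d} (hy : y ∉ Λ) (τ : Site d → ℤˣ) {F : (Site d → ℤˣ) → ℝ}
    (hFm : Measurable F) {T : Set (Site d)} (hF : DependsOn F T) (hyT : y ∉ T) :
    |∫ ω, F ω ∂(U.spec β Λ (spinFlip y τ)) - ∫ ω, F ω ∂(U.spec β Λ τ)| ≤
      R * |∫ ω, F ω * flipWeight U β Λ y ω ∂(U.spec β Λ τ) -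
        (∫ ω, F ω ∂(U.spec β Λ τ)) * ∫ ω, flipWeight U β Λ y ω ∂(U.spec β Λ τ)| := by
  have hγ := U.isSpecification_spec β
  haveI := hγ.isProbability Λ τ
  have hR0 : 0 < R := by linarith
  set ρ := flipWeight U β Λ y with hρ
  have htilt := integral_spec_spinFlip_mul U β Λ hy τ hFm hF hyT
  have hρm : Measurable ρ := measurable_flipWeight U β Λ y
  have hρR : ∀ σ, |ρ σ| ≤ R := fun σ => by
    rw [abs_of_pos (flipWeight_pos U β Λ y σ)]
    exact (hR Λ y σ).2
  have hIρ : R⁻¹ ≤ ∫ ω, ρ ω ∂(U.spec β Λ τ) := by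
    calc R⁻¹ = ∫ _ω, R⁻¹ ∂(U.spec β Λ τ) := by simp
      _ ≤ ∫ ω, ρ ω ∂(U.spec β Λ τ) :=
          integral_mono (integrable_const _)
            (Integrable.of_bound hρm.aestronglyMeasurable R
              (Filter.Eventually.of_forall fun σ => by rw [Real.norm_eq_abs]; exact hρR σ))
            fun σ => (hR Λ y σ).1
  have hI : 0 < ∫ ω, ρ ω ∂(U.spec β Λ τ) := lt_of_lt_of_le (by positivity) hIρ
  have key : ∫ ω, F ω ∂(U.spec β Λ (spinFlip y τ)) - ∫ ω, F ω ∂(U.spec β Λ τ) =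
      (∫ ω, F ω * ρ ω ∂(U.spec β Λ τ) - (∫ ω, F ω ∂(U.spec β Λ τ)) * ∫ ω, ρ ω ∂(U.spec β Λ τ)) /
        ∫ ω, ρ ω ∂(U.spec β Λ τ) := by
    rw [eq_div_iff hI.ne', sub_mul, htilt]
  rw [key, abs_div, abs_of_pos hI, div_eq_mul_inv, mul_comm]
  refine mul_le_mul_of_nonneg_right ?_ (abs_nonneg _)
  calc (∫ ω, ρ ω ∂(U.spec β Λ τ))⁻¹ ≤ (R⁻¹)⁻¹ := inv_anti₀ (by positivity) hIρ
    _ = R := inv_inv R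

/-- **[Mar99] (2.18), telescoped**: if `η` and `η'` agree on the coordinates off `Λ` read by `F`, and every
boundary site of `Λ` where they differ lies in a finite set `S` of sites not read by `F`, then
`|μ_Λ^η(F) − μ_Λ^{η'}(F)| ≤ R Σ_{y∈S} c_y`, where `c_y` bounds the covariances `|μ_Λ^ζ(F; h_y)|` over all `ζ`
(finite-range Markov property + one boundary site at a time). [cite: Martinelli1999, Proposition 2.9, proof, (2.18)] -/
theorem abs_integral_spec_sub_le_sum (U : FRPotential d ℤˣ r) (β : ℝ) {R : ℝ} (hR1 : 1 ≤ R)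
    (hR : ∀ (Λ : Finset (Site d)) (y : Site d) (σ : Site d → ℤˣ),
      R⁻¹ ≤ flipWeight U β Λ y σ ∧ flipWeight U β Λ y σ ≤ R)
    (Λ : Finset (Site d)) {F : (Site d → ℤˣ) → ℝ} (hFm : Measurable F) {T : Set (Site d)}
    (hF : DependsOn F T) (η η' : Site d → ℤˣ) (S : Finset (Site d))
    (hS : ∀ y ∈ rOuterBoundary r Λ, η y ≠ η' y → y ∈ S) (hT : ∀ x ∈ T, x ∉ Λ → η x = η' x)
    (hST : ∀ y ∈ S, y ∉ T) {c : Site d → ℝ}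
    (hc : ∀ y ∈ S, ∀ ζ : Site d → ℤˣ,
      |∫ ω, F ω * flipWeight U β Λ y ω ∂(U.spec β Λ ζ) -
        (∫ ω, F ω ∂(U.spec β Λ ζ)) * ∫ ω, flipWeight U β Λ y ω ∂(U.spec β Λ ζ)| ≤ c y) :
    |∫ ω, F ω ∂(U.spec β Λ η) - ∫ ω, F ω ∂(U.spec β Λ η')| ≤ R * ∑ y ∈ S, c y := by
  classical
  have hR0 : 0 ≤ R := by linarith
  have hc0 : ∀ y ∈ S, 0 ≤ c y := fun y hy => (abs_nonneg _).trans (hc y hy η)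
  set W := rOuterBoundary r Λ with hW
  -- Markov reduction: move `η'` to `η'' = η'` on `W ∩ S`, `= η` elsewhere
  set η'' := (W ∩ S).piecewise η' η with hη''
  have hred : ∫ ω, F ω ∂(U.spec β Λ η') = ∫ ω, F ω ∂(U.spec β Λ η'') := by
    refine U.integral_spec_eq_of_agree β Λ hFm hF (fun x hx hxΛ => ?_) (fun x hx => ?_)
    · by_cases hxs : x ∈ W ∩ S
      · rw [hη'', Finset.piecewise_eq_of_mem _ _ _ hxs]
      · rw [hη'', Finset.piecewise_eq_of_notMem _ _ _ hxs]
        exact (hT x hx hxΛ).symm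
    · by_cases hxs : x ∈ W ∩ S
      · rw [hη'', Finset.piecewise_eq_of_mem _ _ _ hxs]
      · rw [hη'', Finset.piecewise_eq_of_notMem _ _ _ hxs]
        by_contra hne
        exact hxs (Finset.mem_inter.2 ⟨hx, hS x hx (Ne.symm hne)⟩)
  -- one site at a time
  have hstep : ∀ (σ : Site d → ℤˣ) (y : Site d), y ∈ W ∩ S → ∀ s : ℤˣ,
      |∫ ω, F ω ∂(U.spec β Λ (Function.update σ y s)) - ∫ ω, F ω ∂(U.spec β Λ σ)| ≤ R * c y := by
    intro σ y hy s
    obtain ⟨hyW, hyS⟩ := Finset.mem_inter.1 hy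
    have hyΛ : y ∉ Λ := (mem_rOuterBoundary.1 hyW).1
    by_cases hs : s = σ y
    · rw [hs, Function.update_eq_self, sub_self, abs_zero]
      exact mul_nonneg hR0 (hc0 y hyS)
    · have hflip : Function.update σ y s = spinFlip y σ := by
        funext z
        rw [Function.update_apply, spinFlip_apply]
        split_ifs with hz
        · exact Int.units_ne_iff_eq_neg.1 hs
        · rfl
      rw [hflip]
      exact (abs_integral_spec_spinFlip_sub_le U β hR1 hR hyΛ σ hFm hF (hST y hyS)).trans
        (mul_le_mul_of_nonneg_left (hc y hyS σ) hR0)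
  -- induction over the switched boundary sites
  have hind : ∀ S' : Finset (Site d), S' ⊆ W ∩ S →
      |∫ ω, F ω ∂(U.spec β Λ (S'.piecewise η' η)) - ∫ ω, F ω ∂(U.spec β Λ η)| ≤ R * ∑ y ∈ S', c y := by
    intro S'
    induction S' using Finset.induction_on with
    | empty =>
      intro _
      simp
    | insert y S' hyS' ih =>
      intro hsub
      have hy : y ∈ W ∩ S := hsub (Finset.mem_insert_self y S')
      have hsub' : S' ⊆ W ∩ S := fun x hx => hsub (Finset.mem_insert_of_mem hx)
      rw [Finset.piecewise_insert, Finset.sum_insert hyS', mul_add]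
      calc |∫ ω, F ω ∂(U.spec β Λ (Function.update (S'.piecewise η' η) y (η' y))) - ∫ ω, F ω ∂(U.spec β Λ η)|
          ≤ |∫ ω, F ω ∂(U.spec β Λ (Function.update (S'.piecewise η' η) y (η' y))) -
              ∫ ω, F ω ∂(U.spec β Λ (S'.piecewise η' η))| +
            |∫ ω, F ω ∂(U.spec β Λ (S'.piecewise η' η)) - ∫ ω, F ω ∂(U.spec β Λ η)| := abs_sub_le _ _ _
        _ ≤ R * c y + R * ∑ x ∈ S', c x := add_le_add (hstep _ y hy (η' y)) (ih hsub')
  rw [hred, abs_sub_comm]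
  refine (hind (W ∩ S) Finset.Subset.rfl).trans (mul_le_mul_of_nonneg_left ?_ hR0)
  exact Finset.sum_le_sum_of_subset_of_nonneg Finset.inter_subset_right fun y hy _ => hc0 y hy

/-- **[Mar99] Lemma 2.8 (relative density under a boundary flip, via covariances in `U = V ∖ Δ`)**: for
`Δ ⊆ V`, `x ∉ V` with `d(x, Δ) > r`, a `Δ`-local event `A` and every `τ`,
`|μ_V^{τ^x}(A) − μ_V^τ(A)| ≤ 2R² Σ_{y∈Δ} c_y`, where `c_y` bounds `|μ_U^ζ(h_x; h_y)|` over all boundary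
conditions `ζ` (`h_x = e^{−β∇_x H_V}`, `h_y = e^{−β∇_y H_U}`).  Printed: `‖1 − dμ_V^{τ^x}/dμ_V^τ|_Δ‖_∞ ≤
e^{16‖J‖} Σ_{y∈Δ} sup_τ |μ_U^τ(e^{−∇_x H_U}, e^{−∇_y H_U})|`.  Proof: `μ_V^{τ^x}(A) = μ_V^τ(1_A h_x)/μ_V^τ(h_x)`
(the tilt), `μ_V^τ(1_A h_x) = μ_V^τ(1_A μ_U(h_x))` (DLR), and the oscillation of `σ ↦ μ_U^σ(h_x)` over
`σ = τ off V` is at most `R Σ_{y∈Δ} c_y` by (2.18) in the volume `U`. [cite: Martinelli1999, Lemma 2.8] -/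
theorem abs_spec_real_spinFlip_sub_le_sum_cov (U : FRPotential d ℤˣ r) (β : ℝ) {R : ℝ} (hR1 : 1 ≤ R)
    (hR : ∀ (Λ : Finset (Site d)) (y : Site d) (σ : Site d → ℤˣ),
      R⁻¹ ≤ flipWeight U β Λ y σ ∧ flipWeight U β Λ y σ ≤ R)
    {V Δ : Finset (Site d)} (hΔV : Δ ⊆ V) {x : Site d} (hxV : x ∉ V) (hxΔ : ∀ z ∈ Δ, r < supDist z x)
    {A : Set (Site d → ℤˣ)} (hA : MeasurableSet A) (hdA : DependsOn (· ∈ A) (↑Δ : Set (Site d)))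
    (τ : Site d → ℤˣ) {c : Site d → ℝ}
    (hc : ∀ y ∈ Δ, ∀ ζ : Site d → ℤˣ,
      |∫ ω, flipWeight U β V x ω * flipWeight U β (V \ Δ) y ω ∂(U.spec β (V \ Δ) ζ) -
        (∫ ω, flipWeight U β V x ω ∂(U.spec β (V \ Δ) ζ)) *
          ∫ ω, flipWeight U β (V \ Δ) y ω ∂(U.spec β (V \ Δ) ζ)| ≤ c y) :
    |(U.spec β V (spinFlip x τ)).real A - (U.spec β V τ).real A| ≤ 2 * R ^ 2 * ∑ y ∈ Δ, c y := by
  classical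
  have hγ := U.isSpecification_spec β
  haveI := hγ.isProbability V τ
  haveI := hγ.isProbability V (spinFlip x τ)
  have hR0 : 0 < R := by linarith
  have hc0 : ∀ y ∈ Δ, 0 ≤ c y := fun y hy => (abs_nonneg _).trans (hc y hy τ)
  set U' := V \ Δ with hU'
  have hU'V : U' ⊆ V := Finset.sdiff_subset
  set h := flipWeight U β V x with hh
  have hhm : Measurable h := measurable_flipWeight U β V x
  have hhR : ∀ σ, |h σ| ≤ R := fun σ => by
    rw [abs_of_pos (flipWeight_pos U β V x σ)]
    exact (hR V x σ).2
  have hhdep : DependsOn h (↑(rNeighbourhood r x) : Set (Site d)) := dependsOn_flipWeight U β V x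
  -- `G = μ_U(h_x)`
  set G := bavg (U.spec β) U' h with hG
  have hGm : Measurable G := measurable_bavg hγ U' hhm
  have hGR : ∀ σ, |G σ| ≤ R := abs_bavg_le hγ U' hhR
  -- the indicator
  set f : (Site d → ℤˣ) → ℝ := A.indicator 1 with hf
  have hfm : Measurable f := measurable_one.indicator hA
  have hfdep : DependsOn f (↑Δ : Set (Site d)) := fun σ σ' hσ => by
    have hiff : σ ∈ A ↔ σ' ∈ A := Iff.of_eq (hdA hσ)
    by_cases hσA : σ ∈ A
    · rw [hf, Set.indicator_of_mem hσA, Set.indicator_of_mem (hiff.1 hσA), Pi.one_apply, Pi.one_apply]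
    · rw [hf, Set.indicator_of_notMem hσA, Set.indicator_of_notMem (fun h' => hσA (hiff.2 h'))]
  have hf01 : ∀ σ, 0 ≤ f σ ∧ f σ ≤ 1 := fun σ => by
    by_cases hσ : σ ∈ A
    · rw [hf, Set.indicator_of_mem hσ]; simp
    · rw [hf, Set.indicator_of_notMem hσ]; simp
  have hf1 : ∀ σ, |f σ| ≤ 1 := fun σ => by
    rw [abs_of_nonneg (hf01 σ).1]; exact (hf01 σ).2
  have hxΔ' : x ∉ (↑Δ : Set (Site d)) := fun hx => hxV (hΔV (Finset.mem_coe.1 hx))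
  -- Step 1: the tilt in `V`
  have htilt := integral_spec_spinFlip_mul U β V hxV τ hfm hfdep hxΔ'
  -- Step 2: DLR in `V` for the block `U'`
  have hDLR1 : ∫ ω, f ω * h ω ∂(U.spec β V τ) = ∫ ω, f ω * G ω ∂(U.spec β V τ) := by
    have hprodm : Measurable fun ω => f ω * h ω := hfm.mul hhm
    have hprodb : ∀ ω, |f ω * h ω| ≤ 1 * R := fun ω => by
      rw [abs_mul]; exact mul_le_mul (hf1 ω) (hhR ω) (abs_nonneg _) zero_le_one
    rw [← integral_integral_spec hγ hU'V τ hprodm hprodb]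
    refine integral_congr_ae (Filter.Eventually.of_forall fun σ => ?_)
    exact bavg_mul_of_dependsOn hγ U' hfdep (fun z hz hzU => (Finset.mem_sdiff.1 hzU).2 (Finset.mem_coe.1 hz)) h σ
  have hDLR2 : ∫ ω, h ω ∂(U.spec β V τ) = ∫ ω, G ω ∂(U.spec β V τ) :=
    (integral_integral_spec hγ hU'V τ hhm hhR).symm
  -- Step 3: oscillation of `G` on the support of `μ_V^τ`
  set B : ℝ := R * ∑ y ∈ Δ, c y with hB
  have hB0 : 0 ≤ B := mul_nonneg hR0.le (Finset.sum_nonneg hc0)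
  have hosc : ∀ σ : Site d → ℤˣ, (∀ z ∉ V, σ z = τ z) → |G σ - G τ| ≤ B := by
    intro σ hσ
    refine abs_integral_spec_sub_le_sum U β hR1 hR U' hhm hhdep σ τ Δ (fun y hy hne => ?_)
      (fun z hz hzU => ?_) (fun y hy hyT => ?_) (fun y hy ζ => hc y hy ζ)
    · -- a boundary site of `U'` where `σ ≠ τ` lies in `V`, hence in `Δ`
      have hyU : y ∉ U' := (mem_rOuterBoundary.1 hy).1
      have hyV : y ∈ V := by
        by_contra hyV
        exact hne (hσ y hyV)
      rw [hU', Finset.mem_sdiff, not_and, not_not] at hyU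
      exact hyU hyV
    · -- coordinates read by `h` off `U'` lie off `V`
      have hzx : supDist z x ≤ r := mem_rNeighbourhood.1 (Finset.mem_coe.1 hz)
      have hzV : z ∉ V := fun hzV => by
        have hzΔ : z ∈ Δ := by
          by_contra hzΔ
          exact hzU (Finset.mem_sdiff.2 ⟨hzV, hzΔ⟩)
        exact absurd hzx (not_le.2 (hxΔ z hzΔ))
      exact hσ z hzV
    · -- `Δ` is not read by `h`
      have hyx : supDist y x ≤ r := mem_rNeighbourhood.1 (Finset.mem_coe.1 hyT)
      exact absurd hyx (not_le.2 (hxΔ y hy))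
  -- Step 4: the covariance of `1_A` with `G` is at most `2B`
  have hint : ∀ {u : (Site d → ℤˣ) → ℝ}, Measurable u → ∀ {C : ℝ}, (∀ σ, |u σ| ≤ C) →
      Integrable u (U.spec β V τ) := fun {u} hu {C} hC =>
    Integrable.of_bound hu.aestronglyMeasurable C
      (Filter.Eventually.of_forall fun σ => by rw [Real.norm_eq_abs]; exact hC σ)
  have hcov : |∫ ω, f ω * G ω ∂(U.spec β V τ) - (∫ ω, f ω ∂(U.spec β V τ)) * ∫ ω, G ω ∂(U.spec β V τ)| ≤
      2 * B := by
    have hprop := hγ.proper V τ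
    -- replace `G` by `G − G τ`
    have e1 : ∫ ω, f ω * G ω ∂(U.spec β V τ) - (∫ ω, f ω ∂(U.spec β V τ)) * ∫ ω, G ω ∂(U.spec β V τ) =
        ∫ ω, f ω * (G ω - G τ) ∂(U.spec β V τ) -
          (∫ ω, f ω ∂(U.spec β V τ)) * ∫ ω, (G ω - G τ) ∂(U.spec β V τ) := by
      have i1 : Integrable (fun ω => f ω * G ω) (U.spec β V τ) :=
        hint (hfm.mul hGm) (C := 1 * R) fun σ => by
          rw [abs_mul]; exact mul_le_mul (hf1 σ) (hGR σ) (abs_nonneg _) zero_le_one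
      have i2 : Integrable (fun ω => f ω * G τ) (U.spec β V τ) := (hint hfm hf1).mul_const _
      simp only [mul_sub]
      rw [integral_sub i1 i2, integral_sub (hint hGm hGR) (integrable_const _), integral_mul_const,
        integral_const, smul_eq_mul, probReal_univ, one_mul]
      ring
    rw [e1]
    have hb1 : |∫ ω, f ω * (G ω - G τ) ∂(U.spec β V τ)| ≤ B := by
      calc |∫ ω, f ω * (G ω - G τ) ∂(U.spec β V τ)| ≤ ∫ ω, |f ω * (G ω - G τ)| ∂(U.spec β V τ) :=
            abs_integral_le_integral_abs
        _ ≤ ∫ _ω, B ∂(U.spec β V τ) := by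
            refine integral_mono_ae ((hint (u := fun ω => f ω * (G ω - G τ))
              (hfm.mul (hGm.sub measurable_const)) (C := 1 * (R + R)) fun σ => ?_).abs) (integrable_const _) ?_
            · rw [abs_mul]
              exact mul_le_mul (hf1 σ) ((abs_sub _ _).trans (add_le_add (hGR σ) (hGR τ))) (abs_nonneg _)
                zero_le_one
            · filter_upwards [hprop] with ω hω
              rw [abs_mul]
              calc |f ω| * |G ω - G τ| ≤ 1 * B := mul_le_mul (hf1 ω) (hosc ω hω) (abs_nonneg _) zero_le_one
                _ = B := one_mul B
        _ = B := by simp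
    have hb2 : |(∫ ω, f ω ∂(U.spec β V τ)) * ∫ ω, (G ω - G τ) ∂(U.spec β V τ)| ≤ B := by
      rw [abs_mul]
      have h1 : |∫ ω, f ω ∂(U.spec β V τ)| ≤ 1 := by
        calc |∫ ω, f ω ∂(U.spec β V τ)| ≤ ∫ ω, |f ω| ∂(U.spec β V τ) := abs_integral_le_integral_abs
          _ ≤ ∫ _ω, (1 : ℝ) ∂(U.spec β V τ) :=
              integral_mono_of_nonneg (Filter.Eventually.of_forall fun _ => abs_nonneg _)
                (integrable_const _) (Filter.Eventually.of_forall hf1)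
          _ = 1 := by simp
      have h2 : |∫ ω, (G ω - G τ) ∂(U.spec β V τ)| ≤ B := by
        calc |∫ ω, (G ω - G τ) ∂(U.spec β V τ)| ≤ ∫ ω, |G ω - G τ| ∂(U.spec β V τ) :=
              abs_integral_le_integral_abs
          _ ≤ ∫ _ω, B ∂(U.spec β V τ) := by
              refine integral_mono_ae ((hint (hGm.sub measurable_const) (C := R + R) fun σ =>
                (abs_sub _ _).trans (add_le_add (hGR σ) (hGR τ))).abs) (integrable_const _) ?_
              filter_upwards [hprop] with ω hω
              exact hosc ω hω
          _ = B := by simp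
      calc |∫ ω, f ω ∂(U.spec β V τ)| * |∫ ω, (G ω - G τ) ∂(U.spec β V τ)| ≤ 1 * B :=
          mul_le_mul h1 h2 (abs_nonneg _) zero_le_one
        _ = B := one_mul B
    calc |∫ ω, f ω * (G ω - G τ) ∂(U.spec β V τ) -
          (∫ ω, f ω ∂(U.spec β V τ)) * ∫ ω, (G ω - G τ) ∂(U.spec β V τ)|
        ≤ |∫ ω, f ω * (G ω - G τ) ∂(U.spec β V τ)| +
          |(∫ ω, f ω ∂(U.spec β V τ)) * ∫ ω, (G ω - G τ) ∂(U.spec β V τ)| := abs_sub _ _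
      _ ≤ B + B := add_le_add hb1 hb2
      _ = 2 * B := by ring
  -- Step 5: assemble
  have hIh : R⁻¹ ≤ ∫ ω, h ω ∂(U.spec β V τ) := by
    calc R⁻¹ = ∫ _ω, R⁻¹ ∂(U.spec β V τ) := by simp
      _ ≤ ∫ ω, h ω ∂(U.spec β V τ) := integral_mono (integrable_const _) (hint hhm hhR) fun σ => (hR V x σ).1
  have hI : 0 < ∫ ω, h ω ∂(U.spec β V τ) := lt_of_lt_of_le (by positivity) hIh
  have h1 : (U.spec β V (spinFlip x τ)).real A = ∫ ω, f ω ∂(U.spec β V (spinFlip x τ)) := by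
    rw [hf, integral_indicator_one hA]
  have h2 : (U.spec β V τ).real A = ∫ ω, f ω ∂(U.spec β V τ) := by
    rw [hf, integral_indicator_one hA]
  rw [h1, h2]
  have key : ∫ ω, f ω ∂(U.spec β V (spinFlip x τ)) - ∫ ω, f ω ∂(U.spec β V τ) =
      (∫ ω, f ω * G ω ∂(U.spec β V τ) - (∫ ω, f ω ∂(U.spec β V τ)) * ∫ ω, G ω ∂(U.spec β V τ)) /
        ∫ ω, h ω ∂(U.spec β V τ) := by
    rw [eq_div_iff hI.ne', sub_mul, htilt, hDLR1, ← hDLR2]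
  rw [key, abs_div, abs_of_pos hI]
  calc |∫ ω, f ω * G ω ∂(U.spec β V τ) - (∫ ω, f ω ∂(U.spec β V τ)) * ∫ ω, G ω ∂(U.spec β V τ)| /
        ∫ ω, h ω ∂(U.spec β V τ)
      ≤ (2 * B) / R⁻¹ := div_le_div₀ (by positivity) hcov (by positivity) hIh
    _ = 2 * R ^ 2 * ∑ y ∈ Δ, c y := by
        rw [hB]
        field_simp

/-- The `r`-balls of two sites are at ℓ^∞ distance `≥ d(x,y) − 2r`. [cite: Martinelli1999, §2.1] -/
theorem supDist_le_finsetSupDist_rNeighbourhood_add (x y : Site d) :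
    supDist x y ≤ finsetSupDist (rNeighbourhood r x) (rNeighbourhood r y) + 2 * r := by
  have hx : (rNeighbourhood r x).Nonempty := ⟨x, mem_rNeighbourhood.2 (by simp)⟩
  have hy : (rNeighbourhood r y).Nonempty := ⟨y, mem_rNeighbourhood.2 (by simp)⟩
  obtain ⟨a, ha, b, hb, hab⟩ := exists_finsetSupDist_eq hx hy
  rw [hab]
  have h1 : supDist a x ≤ r := mem_rNeighbourhood.1 ha
  have h2 : supDist b y ≤ r := mem_rNeighbourhood.1 hb
  have tri : ∀ p q s : Site d, supDist p s ≤ supDist p q + supDist q s := fun p q s => by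
    rw [supDist_le_iff]
    intro i
    have e1 := natAbs_sub_le_supDist p q i
    have e2 := natAbs_sub_le_supDist q s i
    have : p i - s i = (p i - q i) + (q i - s i) := by ring
    rw [this]
    exact (Int.natAbs_add_le _ _).trans (add_le_add e1 e2)
  have t1 := tri x a b
  have t2 := tri x b y
  rw [supDist_comm] at h1
  omega

/-- **[Mar99] (2.15), third line**: under `SMT(V ∖ Δ, l, m)` (`m ≥ 0`) for all boundary conditions, for
`Δ ⊆ V`, `x ∉ V` with `d(x,Δ) > r` and a `Δ`-local event `A`,
`|μ_V^{τ^x}(A) − μ_V^τ(A)| ≤ 4 R⁴ (2r+1)^{2d} e^{m(l+2r)} Σ_{y∈Δ} e^{−m d(x,y)}` — the printed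
`(2r+1)^{2d} e^{20‖J‖} Σ_{x∈Δ̂} e^{ml − m d(x,y)}` (with [Mar99]'s enlarged `Δ̂`, which makes `V ∖ Δ̂` a multiple
of `Q_{L₀}` so that hypothesis (ii) of Theorem 2.7 applies; here the volume `V ∖ Δ` carrying `SMT` is a
parameter).  Each covariance `|μ_{V∖Δ}^ζ(h_x; h_y)|` is bounded by `SMT` (both weights live on `r`-balls,
`|Λ_{h}| = (2r+1)^d`, `‖h‖ ≤ R`) when `d(N_r x, N_r y) ≥ l`, and by `2R²` otherwise.
[cite: Martinelli1999, Theorem 2.7, proof, (2.15)] -/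
theorem abs_spec_real_spinFlip_sub_le_sum_exp (U : FRPotential d ℤˣ r) (β : ℝ) {R : ℝ} (hR1 : 1 ≤ R)
    (hR : ∀ (Λ : Finset (Site d)) (y : Site d) (σ : Site d → ℤˣ),
      R⁻¹ ≤ flipWeight U β Λ y σ ∧ flipWeight U β Λ y σ ≤ R)
    {V Δ : Finset (Site d)} (hΔV : Δ ⊆ V) {x : Site d} (hxV : x ∉ V) (hxΔ : ∀ z ∈ Δ, r < supDist z x)
    {A : Set (Site d → ℤˣ)} (hA : MeasurableSet A) (hdA : DependsOn (· ∈ A) (↑Δ : Set (Site d)))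
    {l m : ℝ} (hl0 : 0 ≤ l) (hm : 0 ≤ m) (hSMT : ∀ ζ : Site d → ℤˣ, SMT (U.spec β) (V \ Δ) l m)
    (τ : Site d → ℤˣ) :
    |(U.spec β V (spinFlip x τ)).real A - (U.spec β V τ).real A| ≤
      4 * R ^ 4 * (2 * r + 1 : ℝ) ^ (2 * d) * Real.exp (m * (l + 2 * r)) *
        ∑ y ∈ Δ, Real.exp (-(m * supDist x y)) := by
  have hγ := U.isSpecification_spec β
  have hR0 : 0 < R := by linarith
  set c : Site d → ℝ := fun y =>
    2 * R ^ 2 * (2 * r + 1 : ℝ) ^ (2 * d) * Real.exp (m * (l + 2 * r)) * Real.exp (-(m * supDist x y)) with hcdef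
  have hmain := abs_spec_real_spinFlip_sub_le_sum_cov U β hR1 hR hΔV hxV hxΔ hA hdA τ (c := c) ?_
  · refine hmain.trans (le_of_eq ?_)
    rw [hcdef, ← Finset.mul_sum]
    ring
  -- the covariance bounds
  intro y hy ζ
  haveI := hγ.isProbability (V \ Δ) ζ
  set hx := flipWeight U β V x with hhx
  set hy' := flipWeight U β (V \ Δ) y with hhy
  have hxm : Measurable hx := measurable_flipWeight U β V x
  have hym : Measurable hy' := measurable_flipWeight U β (V \ Δ) y
  have hxR : ∀ σ, |hx σ| ≤ R := fun σ => by
    rw [abs_of_pos (flipWeight_pos U β V x σ)]; exact (hR V x σ).2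
  have hyR : ∀ σ, |hy' σ| ≤ R := fun σ => by
    rw [abs_of_pos (flipWeight_pos U β (V \ Δ) y σ)]; exact (hR (V \ Δ) y σ).2
  have hxdep : DependsOn hx (↑(rNeighbourhood r x) : Set (Site d)) := dependsOn_flipWeight U β V x
  have hydep : DependsOn hy' (↑(rNeighbourhood r y) : Set (Site d)) := dependsOn_flipWeight U β (V \ Δ) y
  have hcard : ((rNeighbourhood r x).card : ℝ) * (rNeighbourhood r y).card = (2 * r + 1 : ℝ) ^ (2 * d) := by
    rw [card_rNeighbourhood, card_rNeighbourhood]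
    push_cast
    ring
  -- trivial bound `2R²`
  have hint : ∀ {u : (Site d → ℤˣ) → ℝ}, Measurable u → ∀ {C : ℝ}, (∀ σ, |u σ| ≤ C) →
      |∫ ω, u ω ∂(U.spec β (V \ Δ) ζ)| ≤ C := fun {u} hu {C} hC => by
    calc |∫ ω, u ω ∂(U.spec β (V \ Δ) ζ)| ≤ ∫ ω, |u ω| ∂(U.spec β (V \ Δ) ζ) := abs_integral_le_integral_abs
      _ ≤ ∫ _ω, C ∂(U.spec β (V \ Δ) ζ) :=
          integral_mono_of_nonneg (Filter.Eventually.of_forall fun _ => abs_nonneg _) (integrable_const _)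
            (Filter.Eventually.of_forall hC)
      _ = C := by simp
  have htriv : |∫ ω, hx ω * hy' ω ∂(U.spec β (V \ Δ) ζ) -
      (∫ ω, hx ω ∂(U.spec β (V \ Δ) ζ)) * ∫ ω, hy' ω ∂(U.spec β (V \ Δ) ζ)| ≤ 2 * R ^ 2 := by
    have h1 : |∫ ω, hx ω * hy' ω ∂(U.spec β (V \ Δ) ζ)| ≤ R * R :=
      hint (u := fun ω => hx ω * hy' ω) (hxm.mul hym) fun σ => by
        rw [abs_mul]; exact mul_le_mul (hxR σ) (hyR σ) (abs_nonneg _) hR0.le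
    have h2 : |(∫ ω, hx ω ∂(U.spec β (V \ Δ) ζ)) * ∫ ω, hy' ω ∂(U.spec β (V \ Δ) ζ)| ≤ R * R := by
      rw [abs_mul]; exact mul_le_mul (hint hxm hxR) (hint hym hyR) (abs_nonneg _) hR0.le
    calc _ ≤ |∫ ω, hx ω * hy' ω ∂(U.spec β (V \ Δ) ζ)| +
          |(∫ ω, hx ω ∂(U.spec β (V \ Δ) ζ)) * ∫ ω, hy' ω ∂(U.spec β (V \ Δ) ζ)| := abs_sub _ _
      _ ≤ R * R + R * R := add_le_add h1 h2
      _ = 2 * R ^ 2 := by ring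
  have hdxy := supDist_le_finsetSupDist_rNeighbourhood_add (r := r) x y
  set D : ℕ := finsetSupDist (rNeighbourhood r x) (rNeighbourhood r y) with hD
  by_cases hl : l ≤ (D : ℝ)
  · -- `SMT` applies
    have hsm := hSMT ζ hx hy' (rNeighbourhood r x) (rNeighbourhood r y) R R hxm hym hxdep hydep hxR hyR hl ζ
    refine hsm.trans ?_
    rw [hcdef]
    have hexp : Real.exp (-(m * (D : ℝ))) ≤ Real.exp (m * (l + 2 * r)) * Real.exp (-(m * supDist x y)) := by
      rw [← Real.exp_add, Real.exp_le_exp]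
      have h' : (supDist x y : ℝ) ≤ D + 2 * r := by exact_mod_cast hdxy
      nlinarith [mul_le_mul_of_nonneg_left h' hm, mul_nonneg hm hl0]
    calc ((rNeighbourhood r x).card : ℝ) * (rNeighbourhood r y).card * R * R * Real.exp (-(m * (D : ℝ)))
        = (2 * r + 1 : ℝ) ^ (2 * d) * R ^ 2 * Real.exp (-(m * (D : ℝ))) := by rw [← hcard]; ring
      _ ≤ (2 * r + 1 : ℝ) ^ (2 * d) * R ^ 2 * (Real.exp (m * (l + 2 * r)) * Real.exp (-(m * supDist x y))) :=
          mul_le_mul_of_nonneg_left hexp (by positivity)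
      _ ≤ 2 * R ^ 2 * (2 * r + 1 : ℝ) ^ (2 * d) * Real.exp (m * (l + 2 * r)) * Real.exp (-(m * supDist x y)) := by
          have : 0 ≤ R ^ 2 * (2 * r + 1 : ℝ) ^ (2 * d) * Real.exp (m * (l + 2 * r)) * Real.exp (-(m * supDist x y)) := by
            positivity
          nlinarith
  · -- trivial bound
    refine htriv.trans ?_
    rw [hcdef]
    have hexp : 1 ≤ Real.exp (m * (l + 2 * r)) * Real.exp (-(m * supDist x y)) := by
      rw [← Real.exp_add]
      refine Real.one_le_exp ?_
      have h' : (supDist x y : ℝ) ≤ D + 2 * r := by exact_mod_cast hdxy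
      have hlt : (D : ℝ) < l := not_le.1 hl
      have h'' : (supDist x y : ℝ) ≤ l + 2 * r := by linarith
      nlinarith [mul_le_mul_of_nonneg_left h'' hm]
    have h1 : (1 : ℝ) ≤ (2 * r + 1 : ℝ) ^ (2 * d) := one_le_pow₀ (by linarith [(Nat.cast_nonneg r : (0 : ℝ) ≤ r)])
    calc 2 * R ^ 2 = 2 * R ^ 2 * 1 * 1 := by ring
      _ ≤ 2 * R ^ 2 * (2 * r + 1 : ℝ) ^ (2 * d) * (Real.exp (m * (l + 2 * r)) * Real.exp (-(m * supDist x y))) :=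
          mul_le_mul (mul_le_mul_of_nonneg_left h1 (by positivity)) hexp zero_le_one (by positivity)
      _ = 2 * R ^ 2 * (2 * r + 1 : ℝ) ^ (2 * d) * Real.exp (m * (l + 2 * r)) * Real.exp (-(m * supDist x y)) := by
          ring

end RelativeDensities

end Glauber

end Literature.Probability.LatticeModels

end
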